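import Summits.BirchSwinnertonDyer.BirchSwinnertonDyer.Theorems.EisensteinDepletionAtTwoStarOptBSFTheoremAFormal
import Summits.BirchSwinnertonDyer.BirchSwinnertonDyer.Theorems.EisensteinDepletionAtTwoStarOptBSFPositions
import Literature.NumberTheory.EllipticCurves.Greenberg1999.TwoTorsionDiscriminantConfigurationProofs
import Literature.NumberTheory.EllipticCurves.TwoTorsionHalfPeriodProofs
import HarnessLib

/-!
# Line `star` on crux E1M (stmt-BirchSwinnertonDyer-20341): the position law (T1) «optimal never type A» from THEOREM A and ONE
# square-discriminant statement for Shimura points (the exact research residue of (T1))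

Lead star-p1 GEN 16.  The registered research stub `stub_optimalNotTypeA` (T1: the `X₀(N)`-lattice-optimal curve with a UNIQUE rational
2-torsion abscissa that is FORMAL has it ODD) is reduced BY NAME to
  (SQΣ) «if a rational 2-torsion abscissa `x` of the lattice-optimal `W₀` has Kummer parity trivial on `Γ₁(N)` (i.e. its half-period class lies in
   the Shimura subgroup), then `|Δ(W₀)|` is a rational square: `Δ = c²` or `Δ = −c²`»
— GEN 15's «−□ / position law» for Σ-points (mechanism: `Σ(N)[2]` is off the Néron identity component at every `p ∣ N`, so `v_p(Δ_min)` is even;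
open in print) — using THEOREM A at 2 (tree, `ThmAFormal.kummerParity_formal_of_mem_gamma1`, modulo UBD + Edixhoven): a formal point HAS
Kummer parity trivial on `Γ₁(N)`; type A means the point is even, so `Δ > 0` (`twoTorsionOdd_of_Δ_neg`), hence `Δ = c²`, and then the
2-division cubic splits over `ℚ` (`exists_ne_hasRationalTwoTorsionX_of_Δ_eq_sq`: with a rational root `r`, `4Δ = β²(α² − 32β)` and
`α² − 32β` is the discriminant of the complementary quadratic), contradicting uniqueness.

* `exists_ne_hasRationalTwoTorsionX_of_Δ_eq_sq` — `Δ = c² ≠ 0` and one rational 2-torsion abscissa ⇒ a second one (elementary);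
* `optimalNotTypeA_of_sigmaSquare` — (T1) verbatim ⇐ UBD + Edixhoven + (SQΣ).

CONDITIONAL on the two prints and on (SQΣ) (stated inline); no `sorry`, no new definition; nothing here reads `r_an`; BSD is NOT proved.
-/

set_option linter.dupNamespace false
set_option autoImplicit false

noncomputable section

open scoped Classical MatrixGroups
open CongruenceSubgroup
open WeierstrassCurve Literature.NumberTheory.EllipticCurves Literature.NumberTheory.EllipticCurves.Greenberg1999
open Literature.NumberTheory.EllipticCurves.ModularForms

namespace Summit.BirchSwinnertonDyer.BirchSwinnertonDyer.Theorems.DepletionAtTwo.TypeAResidue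

/-! ### Square discriminant and one rational root ⇒ full rational 2-torsion -/

/-- **`Δ = c² ≠ 0` and a rational 2-torsion abscissa `r` ⇒ a second rational 2-torsion abscissa.**  With `α = b₂ + 12r`,
`β = b₄ + rb₂ + 6r²`: `4Δ = β²(α² − 32β)` (tree `four_mul_Δ_eq_of_isTwoTorsionNF_smul`), and `α² − 32β = B² − 16C` is the discriminant of the
complementary quadratic `4x² + Bx + C` (`B = b₂ + 4r`, `C = 2b₄ + rb₂ + 4r²`) of the 2-division cubic; so `s = 2c/β` is a rational square root and
`x± = (−B ± s)/8` are rational roots, not both equal to `r` since `s ≠ 0`. [cite: SilvermanAEC2009, III.1 and III.4 Example 4.5] -/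
theorem exists_ne_hasRationalTwoTorsionX_of_Δ_eq_sq (W : WeierstrassCurve ℚ) [W.IsElliptic] {r : ℚ} (hr : HasRationalTwoTorsionX W r)
    {c : ℚ} (hΔ : W.Δ = c ^ 2) : ∃ x₂ : ℚ, x₂ ≠ r ∧ HasRationalTwoTorsionX W x₂ := by
  obtain ⟨y, hEq, h2⟩ := hr
  have hcubic := fourXCubed_add_eq_zero_of_twoTorsion hEq h2
  set C : VariableChange ℚ := ⟨1, r, -W.a₁ / 2, y⟩ with hC
  have hns : W.toAffine.Nonsingular r y := (WeierstrassCurve.Affine.equation_iff_nonsingular).mp hEq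
  have hy : y = W.toAffine.negY r y := by
    rw [WeierstrassCurve.Affine.negY]; linear_combination h2
  haveI : (C • W).IsTwoTorsionNF := isTwoTorsionNF_smul_of_two_nsmul_eq_zero two_ne_zero hns hy
  have h4Δ := four_mul_Δ_eq_of_isTwoTorsionNF_smul W C
  have hCr : C.r = r := rfl
  rw [hCr] at h4Δ
  set α : ℚ := W.b₂ + 12 * r with hα
  set β : ℚ := W.b₄ + r * W.b₂ + 6 * r ^ 2 with hβ
  have hΔ0 : W.Δ ≠ 0 := by rw [← W.coe_Δ']; exact W.Δ'.ne_zero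
  have hc0 : c ≠ 0 := by rintro rfl; exact hΔ0 (by rw [hΔ]; ring)
  have hβ0 : β ≠ 0 := by
    intro h0
    apply hΔ0
    have : 4 * W.Δ = 0 := by rw [h4Δ, h0]; ring
    linarith
  set s : ℚ := 2 * c / β with hs
  have hs2 : s ^ 2 = α ^ 2 - 32 * β := by
    have h : β ^ 2 * (α ^ 2 - 32 * β) = 4 * c ^ 2 := by rw [← hΔ, h4Δ]; ring
    have hsβ : s * β = 2 * c := by rw [hs]; exact div_mul_cancel₀ _ hβ0
    have h' : (s ^ 2 - (α ^ 2 - 32 * β)) * β ^ 2 = 0 := by linear_combination (s * β + 2 * c) * hsβ - h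
    exact sub_eq_zero.mp ((mul_eq_zero.mp h').resolve_right (pow_ne_zero 2 hβ0))
  have hs0 : s ≠ 0 := by
    rw [hs]; exact div_ne_zero (mul_ne_zero two_ne_zero hc0) hβ0
  set B : ℚ := W.b₂ + 4 * r with hB
  set Cq : ℚ := 2 * W.b₄ + r * W.b₂ + 4 * r ^ 2 with hCq
  have hdisc : B ^ 2 - 16 * Cq = α ^ 2 - 32 * β := by rw [hB, hCq, hα, hβ]; ring
  -- the two roots of the complementary quadratic
  have hroot : ∀ ε : ℚ, ε ^ 2 = 1 → 4 * ((-B + ε * s) / 8) ^ 3 + W.b₂ * ((-B + ε * s) / 8) ^ 2 +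
      2 * W.b₄ * ((-B + ε * s) / 8) + W.b₆ = 0 := by
    intro ε hε
    have key : ∀ x : ℚ, 4 * x ^ 3 + W.b₂ * x ^ 2 + 2 * W.b₄ * x + W.b₆ =
        (x - r) * (((8 * x + B) ^ 2 - (B ^ 2 - 16 * Cq)) / 16) + (4 * r ^ 3 + W.b₂ * r ^ 2 + 2 * W.b₄ * r + W.b₆) := by
      intro x; rw [hB, hCq]; ring
    rw [key, hcubic, hdisc, ← hs2]
    have h8 : 8 * ((-B + ε * s) / 8) + B = ε * s := by ring
    rw [h8, mul_pow, hε]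
    ring
  have hplus := hroot 1 (by norm_num)
  have hminus := hroot (-1) (by norm_num)
  by_cases hne : (-B + 1 * s) / 8 ≠ r
  · exact ⟨_, hne, SfPositions.hasRationalTwoTorsionX_of_cubic W hplus⟩
  · push Not at hne
    refine ⟨(-B + -1 * s) / 8, fun h ↦ hs0 ?_, SfPositions.hasRationalTwoTorsionX_of_cubic W hminus⟩
    linear_combination 4 * (hne - h)

/-! ### (T1) from THEOREM A and (SQΣ) -/

/-- **(T1) «the lattice-optimal curve is never of type A» from THEOREM A at 2 and (SQΣ).**  Hypotheses: UBD, Edixhoven's integrality (tree named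
facts), and (SQΣ) stated inline: «a rational 2-torsion abscissa of the lattice-optimal `W₀` whose Kummer parity is trivial on `Γ₁(N)` forces
`Δ(W₀) = ±c²`».  Conclusion: the registered stub `stub_optimalNotTypeA` verbatim.  Proof: the formal point's parity is trivial on `Γ₁(N)`
(`ThmAFormal.kummerParity_formal_of_mem_gamma1`); by (SQΣ) `Δ = ±c²`; if the point were even, `Δ > 0` (`twoTorsionOdd_of_Δ_neg`), so `Δ = c²` and
`exists_ne_hasRationalTwoTorsionX_of_Δ_eq_sq` contradicts uniqueness. CONDITIONAL on UBD, Edixhoven, (SQΣ).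
[cite: GreenbergLNM1716, §5 Remark (p. 121)] [cite: CalegariDimitrovTang2025, Thm. 1.0.1] [cite: Edixhoven1991, Prop. 2] -/
theorem optimalNotTypeA_of_sigmaSquare
    (hU : Literature.NumberTheory.Automorphic.CalegariDimitrovTang2025_unboundedDenominators)
    (hEd : edixhoven_optimalManinConstant_integral)
    (hSQ : ∀ (W₀ : WeierstrassCurve ℚ) [W₀.IsElliptic] [W₀.IsGloballyMinimal]
      ⦃N : ℕ⦄ [NeZero N] (f : CuspForm (Gamma0 N) 2), IsNewformOf W₀ f → IsOrdinaryAt W₀ 2 →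
      ∀ (L₀ : PeriodPair), IsNeronLatticeOf (W₀.baseChange ℂ) L₀ → ∀ (q : ℚ), q ≠ 0 →
      (∀ z ∈ periodLattice f, (q : ℂ) * z ∈ L₀.lattice) → (∀ z ∈ L₀.lattice, ∃ w ∈ periodLattice f, z = (q : ℂ) * w) →
      ∀ (x : ℚ), HasRationalTwoTorsionX W₀ x →
      ∀ (lam : ℂ), lam ∈ L₀.lattice → lam / 2 ∉ L₀.lattice →
        L₀.weierstrassP (lam / 2) - ((W₀.b₂ : ℚ) : ℂ) / 12 = ((x : ℚ) : ℂ) →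
      (∀ (γ : SL(2, ℤ)) (hγ : γ ∈ Gamma0 N), γ ∈ Gamma1 N →
        ∃ k : ℤ, ∃ w ∈ L₀.lattice, (q : ℂ) * cuspSymbol f ⟨γ, hγ⟩ = (k : ℂ) * lam + 2 * w) →
      ∃ c : ℚ, W₀.Δ = c ^ 2 ∨ W₀.Δ = -c ^ 2) :
    ∀ (W₀ : WeierstrassCurve ℚ) [W₀.IsElliptic] [W₀.IsGloballyMinimal]
      ⦃N : ℕ⦄ [NeZero N] (f : CuspForm (Gamma0 N) 2), IsNewformOf W₀ f → IsOrdinaryAt W₀ 2 →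
      ∀ (L₀ : PeriodPair), IsNeronLatticeOf (W₀.baseChange ℂ) L₀ → ∀ (q : ℚ), q ≠ 0 →
      (∀ z ∈ periodLattice f, (q : ℂ) * z ∈ L₀.lattice) → (∀ z ∈ L₀.lattice, ∃ w ∈ periodLattice f, z = (q : ℂ) * w) →
      ∀ (x₀ : ℚ), HasUniqueRationalTwoTorsionX W₀ x₀ → TwoTorsionRamifiedAtTwo x₀ → TwoTorsionOdd W₀ x₀ := by
  intro W₀ _ _ N _ f hW₀ hord L₀ hL₀ q hq hin hout x₀ hu hram
  by_contra hno
  obtain ⟨lam, hlam, hlam2, hwp⟩ := exists_half_period_of_hasRationalTwoTorsionX W₀ L₀ hL₀ hu.1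
  have hpar := ThmAFormal.kummerParity_formal_of_mem_gamma1 hU hEd W₀ f hW₀ L₀ hL₀ q hq hin hout x₀ hu.1 hram lam hlam hlam2 hwp
  obtain ⟨c, hc⟩ := hSQ W₀ f hW₀ hord L₀ hL₀ q hq hin hout x₀ hu.1 lam hlam hlam2 hwp hpar
  have hΔ0 : W₀.Δ ≠ 0 := by rw [← W₀.coe_Δ']; exact W₀.Δ'.ne_zero
  rcases hc with hsq | hneg
  · obtain ⟨x₂, hne, hx₂⟩ := exists_ne_hasRationalTwoTorsionX_of_Δ_eq_sq W₀ hu.1 hsq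
    exact hne (hu.2 x₂ hx₂)
  · have hc0 : c ≠ 0 := by rintro rfl; exact hΔ0 (by rw [hneg]; ring)
    have hlt : W₀.Δ < 0 := by rw [hneg]; exact neg_neg_of_pos (by positivity)
    exact hno (twoTorsionOdd_of_Δ_neg W₀ hlt hu.1)

/-- **(T1) from THEOREM A and (SQΣ) restricted to FORMAL points** — the same as `optimalNotTypeA_of_sigmaSquare`, with the square-discriminant
hypothesis asked only for rational 2-torsion abscissae that are RAMIFIED at 2 (the only case the proof uses; by THEOREM A these are exactly the points
to which it applies).  This is the form registered as the research stub `stub_sigmaSquare` of Lines/star.lean v9.1. CONDITIONAL on UBD, Edixhoven, (SQΣ_f).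
[cite: GreenbergLNM1716, §5 Remark (p. 121)] [cite: CalegariDimitrovTang2025, Thm. 1.0.1] [cite: Edixhoven1991, Prop. 2] -/
theorem optimalNotTypeA_of_sigmaSquareFormal
    (hU : Literature.NumberTheory.Automorphic.CalegariDimitrovTang2025_unboundedDenominators)
    (hEd : edixhoven_optimalManinConstant_integral)
    (hSQ : ∀ (W₀ : WeierstrassCurve ℚ) [W₀.IsElliptic] [W₀.IsGloballyMinimal]
      ⦃N : ℕ⦄ [NeZero N] (f : CuspForm (Gamma0 N) 2), IsNewformOf W₀ f → IsOrdinaryAt W₀ 2 →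
      ∀ (L₀ : PeriodPair), IsNeronLatticeOf (W₀.baseChange ℂ) L₀ → ∀ (q : ℚ), q ≠ 0 →
      (∀ z ∈ periodLattice f, (q : ℂ) * z ∈ L₀.lattice) → (∀ z ∈ L₀.lattice, ∃ w ∈ periodLattice f, z = (q : ℂ) * w) →
      ∀ (x : ℚ), HasRationalTwoTorsionX W₀ x → TwoTorsionRamifiedAtTwo x →
      ∀ (lam : ℂ), lam ∈ L₀.lattice → lam / 2 ∉ L₀.lattice →
        L₀.weierstrassP (lam / 2) - ((W₀.b₂ : ℚ) : ℂ) / 12 = ((x : ℚ) : ℂ) →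
      (∀ (γ : SL(2, ℤ)) (hγ : γ ∈ Gamma0 N), γ ∈ Gamma1 N →
        ∃ k : ℤ, ∃ w ∈ L₀.lattice, (q : ℂ) * cuspSymbol f ⟨γ, hγ⟩ = (k : ℂ) * lam + 2 * w) →
      ∃ c : ℚ, W₀.Δ = c ^ 2 ∨ W₀.Δ = -c ^ 2) :
    ∀ (W₀ : WeierstrassCurve ℚ) [W₀.IsElliptic] [W₀.IsGloballyMinimal]
      ⦃N : ℕ⦄ [NeZero N] (f : CuspForm (Gamma0 N) 2), IsNewformOf W₀ f → IsOrdinaryAt W₀ 2 →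
      ∀ (L₀ : PeriodPair), IsNeronLatticeOf (W₀.baseChange ℂ) L₀ → ∀ (q : ℚ), q ≠ 0 →
      (∀ z ∈ periodLattice f, (q : ℂ) * z ∈ L₀.lattice) → (∀ z ∈ L₀.lattice, ∃ w ∈ periodLattice f, z = (q : ℂ) * w) →
      ∀ (x₀ : ℚ), HasUniqueRationalTwoTorsionX W₀ x₀ → TwoTorsionRamifiedAtTwo x₀ → TwoTorsionOdd W₀ x₀ := by
  intro W₀ _ _ N _ f hW₀ hord L₀ hL₀ q hq hin hout x₀ hu hram
  by_contra hno
  obtain ⟨lam, hlam, hlam2, hwp⟩ := exists_half_period_of_hasRationalTwoTorsionX W₀ L₀ hL₀ hu.1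
  have hpar := ThmAFormal.kummerParity_formal_of_mem_gamma1 hU hEd W₀ f hW₀ L₀ hL₀ q hq hin hout x₀ hu.1 hram lam hlam hlam2 hwp
  obtain ⟨c, hc⟩ := hSQ W₀ f hW₀ hord L₀ hL₀ q hq hin hout x₀ hu.1 hram lam hlam hlam2 hwp hpar
  have hΔ0 : W₀.Δ ≠ 0 := by rw [← W₀.coe_Δ']; exact W₀.Δ'.ne_zero
  rcases hc with hsq | hneg
  · obtain ⟨x₂, hne, hx₂⟩ := exists_ne_hasRationalTwoTorsionX_of_Δ_eq_sq W₀ hu.1 hsq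
    exact hne (hu.2 x₂ hx₂)
  · have hc0 : c ≠ 0 := by rintro rfl; exact hΔ0 (by rw [hneg]; ring)
    have hlt : W₀.Δ < 0 := by rw [hneg]; exact neg_neg_of_pos (by positivity)
    exact hno (twoTorsionOdd_of_Δ_neg W₀ hlt hu.1)

end Summit.BirchSwinnertonDyer.BirchSwinnertonDyer.Theorems.DepletionAtTwo.TypeAResidue

end
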